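import Mathlib
import HarnessLib
import Literature.NumberTheory.LFunctions.RiemannXi
import Literature.NumberTheory.LFunctions.RiemannXiProofs
import Literature.NumberTheory.LFunctions.RiemannXiLogDeriv
import Literature.NumberTheory.LFunctions.GeneralizedRH
import Summits.RiemannHypothesis.RiemannHypothesis.Theorems.DeBrangesSuzukiDoorDefs

/-!
# RiemannHypothesis / DeBrangesSuzukiDoor — H2: symbol rigidity (no blind spot of the single operator)

Port (verbatim up to namespace/imports) of §"SymbolRigidity" of the rh-dbr scratch module
`SuzukiCanonicalWindow.lean` (sha16 `82bfcc5f80debbaf`, lines 1486–1784; referee read PASS, hard axiom guard,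
2026-08-25T19:28Z), for route `route-RiemannHypothesis-DeBrangesSuzukiDoor`, support item
`DoorModuloKernel` (stmt-RiemannHypothesis-19729).

Main result `rh_of_symbolQuotientOn` (RH-FREE theorem ABOUT an RH-EQUIVALENT·DERIVED criterion): if for some
`θ ≠ 0` the symbol `Θ_θ` (`SuzukiDoor.limTheta`) satisfies `Θ_θ · F = G` on a half-plane `Im z > a`, `a ≥ 1/2`,
with `G, F` holomorphic on `ℂ₊ = {Im z > 0}` and `F ≢ 0`, then `RiemannHypothesis`. Mechanism (TARGET-v3 §G):
with `f(z) = ξ(1/2 - iz)` (entire) and `Θ_θ = exp(c f'/f)`, `c = -2θ i`, differentiating `G = Θ_θ F` gives the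
identity `(G'F - GF') f² = c (f''f - f'²) G F` of functions holomorphic on `ℂ₊`, hence valid on all of `ℂ₊`
(identity theorem); at an off-line zero `z₀ ∈ ℂ₊` of `f` of order `m ≥ 1` (from `¬RH` via
`riemannHypothesis_iff_strip_holds`, `riemannXi_eq_zero_iff_holds`, `ξ(1-s) = ξ(s)`) the local factorisations
of `f, F, G` turn it into `(z - z₀) A = c B` near `z₀` with `B(z₀) = -m G₁(z₀) F₁(z₀) ≠ 0` — contradiction
along `𝓝[≠] z₀`. Tree inputs: `differentiable_riemannXi`, `riemannXi_one_sub`,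
`riemannXi_ne_zero_of_one_le_re`, `riemannXi_eq_zero_iff_holds`, `riemannHypothesis_iff_strip_holds`.
Nothing in this file bears on the truth of RH.
-/

noncomputable section

-- D-0017: `Summit.<S>.<S>.…` is the designed namespace of a single-problem summit.
set_option linter.dupNamespace false

open MeasureTheory Complex
open Filter Topology

namespace Summit.RiemannHypothesis.RiemannHypothesis.Theorems.SuzukiDoor

open Literature.NumberTheory.LFunctions

/-- `f(z) = ξ(1/2 - i z)` (entire). -/
private noncomputable def xiRot (z : ℂ) : ℂ := riemannXi (1 / 2 - I * z)

/-- `f'(z) = -i ξ'(1/2 - iz)`. -/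
private theorem hasDerivAt_xiRot (z : ℂ) :
    HasDerivAt xiRot (-I * deriv riemannXi (1 / 2 - I * z)) z := by
  have h1 : HasDerivAt (fun w : ℂ => 1 / 2 - I * w) (-I) z := by
    simpa using ((hasDerivAt_id z).const_mul I).const_sub (1 / 2 : ℂ)
  have h2 : HasDerivAt riemannXi (deriv riemannXi (1 / 2 - I * z)) (1 / 2 - I * z) :=
    (differentiable_riemannXi _).hasDerivAt
  have h : HasDerivAt xiRot (deriv riemannXi (1 / 2 - I * z) * -I) z := h2.comp z h1
  convert h using 1
  ring

/-- `f` is entire. -/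
private theorem differentiable_xiRot : Differentiable ℂ xiRot :=
  fun z => (hasDerivAt_xiRot z).differentiableAt

/-- `Θ_θ = exp(c · f'/f)` with `c = -2θ i`. -/
private theorem limTheta_eq_exp (θ : ℝ) (z : ℂ) :
    limTheta θ z = Complex.exp ((-2 * θ * I) * (deriv xiRot z / xiRot z)) := by
  unfold limTheta
  congr 1
  rw [(hasDerivAt_xiRot z).deriv]
  show -2 * (θ : ℂ) * (deriv riemannXi (1 / 2 - I * z) / riemannXi (1 / 2 - I * z)) =
    (-2 * θ * I) * (-I * deriv riemannXi (1 / 2 - I * z) / riemannXi (1 / 2 - I * z))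
  have hI : I * I = -1 := I_mul_I
  rw [mul_div_assoc]
  linear_combination (-2 * (θ : ℂ) * (deriv riemannXi (1 / 2 - I * z) / riemannXi (1 / 2 - I * z))) * hI

/-- Derivative of a local factorisation `H = (z - z₀)^n • H₁` near `z₀`. -/
private theorem deriv_of_eventuallyEq_pow_smul {H H₁ : ℂ → ℂ} {z₀ : ℂ} {n : ℕ}
    (hH₁ : AnalyticAt ℂ H₁ z₀) (hev : ∀ᶠ z in 𝓝 z₀, H z = (z - z₀) ^ n • H₁ z) :
    ∀ᶠ z in 𝓝 z₀, deriv H z = n * (z - z₀) ^ (n - 1) * H₁ z + (z - z₀) ^ n * deriv H₁ z := by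
  have hev' : ∀ᶠ z in 𝓝 z₀, H =ᶠ[𝓝 z] fun w => (w - z₀) ^ n * H₁ w := by
    filter_upwards [hev.eventually_nhds] with z hz
    filter_upwards [hz] with w hw
    simpa [smul_eq_mul] using hw
  filter_upwards [hev', hH₁.eventually_analyticAt] with z hz hH₁z
  rw [hz.deriv_eq]
  have h1 : HasDerivAt (fun w : ℂ => (w - z₀) ^ n) (n * (z - z₀) ^ (n - 1)) z := by
    have h := (hasDerivAt_pow n (z - z₀)).comp z ((hasDerivAt_id' z).sub_const z₀)
    simpa [Function.comp_def, mul_one] using h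
  exact (h1.mul hH₁z.differentiableAt.hasDerivAt).deriv

/-- `n w^{n-1} w² = n w^{n+1}` (also for `n = 0`). -/
private theorem natCast_mul_pow_pred_mul_sq (n : ℕ) (w : ℂ) :
    (n : ℂ) * w ^ (n - 1) * w ^ 2 = n * w ^ (n + 1) := by
  cases n with
  | zero => simp
  | succ n => simp [pow_succ]; ring

/-- RH-FREE THEOREM (PROVED): a holomorphic quotient representation `Θ_θ · F = G` on ANY upper
half-plane `Im z > a` (`a ≥ 1/2`, e.g. the half-plane of absolute convergence `a = 1`) with `G, F`
holomorphic on `ℂ₊`, `F ≢ 0`, forces RH (`θ ≠ 0`). -/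
theorem rh_of_symbolQuotientOn {θ a : ℝ} (hθ : θ ≠ 0) (ha : 1 / 2 ≤ a) {G F : ℂ → ℂ}
    (hG : DifferentiableOn ℂ G {z : ℂ | 0 < z.im}) (hF : DifferentiableOn ℂ F {z : ℂ | 0 < z.im})
    (hF0 : ∃ z : ℂ, 0 < z.im ∧ F z ≠ 0) (hGF : ∀ z : ℂ, a < z.im → limTheta θ z * F z = G z) :
    _root_.RiemannHypothesis := by
  obtain ⟨z₁, hz₁, hFz₁⟩ := hF0
  by_contra hRH
  -- Step 0: an off-line zero, i.e. `z₀ ∈ ℂ₊` with `f z₀ = 0`.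
  obtain ⟨z₀, hz₀, hfz₀⟩ : ∃ z₀ : ℂ, 0 < z₀.im ∧ xiRot z₀ = 0 := by
    have hstrip := riemannHypothesis_iff_strip_holds
    unfold riemannHypothesis_iff_strip at hstrip
    rw [hstrip] at hRH
    unfold RiemannHypothesisStrip at hRH
    simp only [not_forall, exists_prop] at hRH
    obtain ⟨s, hζ, h0, h1, hne⟩ := hRH
    have hξ : riemannXi s = 0 := (riemannXi_eq_zero_iff_holds s).2 ⟨hζ, h0, h1⟩
    have hI : I * I = -1 := I_mul_I
    by_cases hlt : 1 / 2 < s.re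
    · refine ⟨I * (s - 1 / 2), ?_, ?_⟩
      · have : (I * (s - 1 / 2)).im = s.re - 1 / 2 := by simp
        rw [this]; linarith
      · show riemannXi (1 / 2 - I * (I * (s - 1 / 2))) = 0
        have : (1 / 2 : ℂ) - I * (I * (s - 1 / 2)) = s := by
          linear_combination (-(s - 1 / 2)) * hI
        rw [this, hξ]
    · refine ⟨I * (1 / 2 - s), ?_, ?_⟩
      · have : (I * (1 / 2 - s)).im = 1 / 2 - s.re := by simp
        rw [this]
        have : s.re < 1 / 2 := lt_of_le_of_ne (not_lt.mp hlt) hne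
        linarith
      · show riemannXi (1 / 2 - I * (I * (1 / 2 - s))) = 0
        have : (1 / 2 : ℂ) - I * (I * (1 / 2 - s)) = 1 - s := by
          linear_combination (-(1 / 2 - s)) * hI
        rw [this, riemannXi_one_sub, hξ]
  -- Step 1: set-up on `U = ℂ₊`.
  set c : ℂ := -2 * θ * I with hc
  have hc0 : c ≠ 0 := by
    simp only [hc, ne_eq, mul_eq_zero, I_ne_zero, Complex.ofReal_eq_zero, hθ, neg_eq_zero,
      OfNat.ofNat_ne_zero, or_self, not_false_eq_true]
  set U : Set ℂ := {z | 0 < z.im} with hU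
  have hUo : IsOpen U := isOpen_lt continuous_const Complex.continuous_im
  have hUc : IsPreconnected U := (convex_halfSpace_im_gt 0).isPreconnected
  set zI : ℂ := ((a + 1 : ℝ) : ℂ) * I with hzI
  have hzIim : zI.im = a + 1 := by simp [hzI]
  have hIU : zI ∈ U := by show 0 < zI.im; rw [hzIim]; linarith
  have hVo : IsOpen {w : ℂ | a < w.im} := isOpen_lt continuous_const Complex.continuous_im
  have hIV : zI ∈ {w : ℂ | a < w.im} := by
    show a < zI.im
    rw [hzIim]; linarith
  have hGa : AnalyticOnNhd ℂ G U := hG.analyticOnNhd hUo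
  have hFa : AnalyticOnNhd ℂ F U := hF.analyticOnNhd hUo
  have hfa : AnalyticOnNhd ℂ xiRot U := differentiable_xiRot.differentiableOn.analyticOnNhd hUo
  set u : ℂ → ℂ := fun z => deriv xiRot z / xiRot z with hu
  have hΘ : ∀ z, limTheta θ z = Complex.exp (c * u z) := fun z => limTheta_eq_exp θ z
  have hfV : ∀ z : ℂ, a < z.im → xiRot z ≠ 0 := by
    intro z hz
    show riemannXi (1 / 2 - I * z) ≠ 0
    exact riemannXi_ne_zero_of_one_le_re (by simp; linarith)
  -- Step 2: the global identity `P = Q` on `U`.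
  set P : ℂ → ℂ := fun z => (deriv G z * F z - G z * deriv F z) * xiRot z ^ 2 with hP
  set Q : ℂ → ℂ := fun z =>
    c * ((deriv (deriv xiRot) z * xiRot z - deriv xiRot z ^ 2) * G z * F z) with hQdef
  have hPa : AnalyticOnNhd ℂ P U :=
    ((hGa.deriv.mul hFa).sub (hGa.mul hFa.deriv)).mul (hfa.pow 2)
  have hQa : AnalyticOnNhd ℂ Q U :=
    analyticOnNhd_const.mul ((((hfa.deriv.deriv.mul hfa).sub (hfa.deriv.pow 2)).mul hGa).mul hFa)
  have hPQV : ∀ z : ℂ, a < z.im → P z = Q z := by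
    intro z hz
    have hfz : xiRot z ≠ 0 := hfV z hz
    have hz0 : z ∈ U := by show 0 < z.im; linarith
    have hGev : G =ᶠ[𝓝 z] fun w => Complex.exp (c * u w) * F w := by
      filter_upwards [hVo.mem_nhds hz] with w hw
      rw [← hΘ]; exact (hGF w hw).symm
    have hf_an : AnalyticAt ℂ xiRot z := hfa z hz0
    have hdf : HasDerivAt xiRot (deriv xiRot z) z := hf_an.differentiableAt.hasDerivAt
    have hddf : HasDerivAt (deriv xiRot) (deriv (deriv xiRot) z) z :=
      hf_an.deriv.differentiableAt.hasDerivAt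
    have hu' : HasDerivAt u
        ((deriv (deriv xiRot) z * xiRot z - deriv xiRot z * deriv xiRot z) / xiRot z ^ 2) z :=
      hddf.div hdf hfz
    have hdF : HasDerivAt F (deriv F z) z := (hFa z hz0).differentiableAt.hasDerivAt
    have hprod := ((hu'.const_mul c).cexp).mul hdF
    have hderivG : deriv G z = Complex.exp (c * u z) *
        (c * ((deriv (deriv xiRot) z * xiRot z - deriv xiRot z * deriv xiRot z) / xiRot z ^ 2)) *
        F z + Complex.exp (c * u z) * deriv F z := by
      rw [hGev.deriv_eq]; exact hprod.deriv
    have hGz : G z = Complex.exp (c * u z) * F z := hGev.self_of_nhds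
    simp only [hP, hQdef]
    rw [hderivG, hGz]
    field_simp
    ring
  have hPQ : Set.EqOn P Q U := by
    have hev : P =ᶠ[𝓝 zI] Q := by
      filter_upwards [hVo.mem_nhds hIV] with w hw
      exact hPQV w hw
    exact hPa.eqOn_of_preconnected_of_eventuallyEq hQa hUc hIU hev
  -- Step 3: local factorisations at `z₀`.
  have hf_ne : ¬ (∀ᶠ z in 𝓝 z₀, xiRot z = 0) := by
    intro hev
    have h0 := hfa.eqOn_zero_of_preconnected_of_eventuallyEq_zero hUc hz₀ hev
    exact hfV zI hIV (h0 hIU)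
  obtain ⟨m, f₁, hf₁a, hf₁0, hfev⟩ := (hfa z₀ hz₀).exists_eventuallyEq_pow_smul_nonzero_iff.2 hf_ne
  have hm : m ≠ 0 := by
    intro h
    have h1 := hfev.self_of_nhds
    rw [h, pow_zero, one_smul, hfz₀] at h1
    exact hf₁0 h1.symm
  obtain ⟨m', rfl⟩ : ∃ m' : ℕ, m = m' + 1 := ⟨m - 1, by omega⟩
  have hF_ne : ¬ (∀ᶠ z in 𝓝 z₀, F z = 0) := by
    intro hev
    have h0 := hFa.eqOn_zero_of_preconnected_of_eventuallyEq_zero hUc hz₀ hev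
    exact hFz₁ (h0 hz₁)
  obtain ⟨k, F₁, hF₁a, hF₁0, hFev⟩ := (hFa z₀ hz₀).exists_eventuallyEq_pow_smul_nonzero_iff.2 hF_ne
  have hG_ne : ¬ (∀ᶠ z in 𝓝 z₀, G z = 0) := by
    intro hev
    have h0 := hGa.eqOn_zero_of_preconnected_of_eventuallyEq_zero hUc hz₀ hev
    have hFevI : ∀ᶠ w in 𝓝 zI, F w = 0 := by
      filter_upwards [hVo.mem_nhds hIV] with w hw
      have h1 := hGF w hw
      have hw' : a < w.im := hw
      have hGw : G w = 0 := h0 (show 0 < w.im by linarith)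
      rw [hGw, hΘ] at h1
      rcases mul_eq_zero.1 h1 with h | h
      · exact absurd h (Complex.exp_ne_zero _)
      · exact h
    have h00 := hFa.eqOn_zero_of_preconnected_of_eventuallyEq_zero hUc hIU hFevI
    exact hFz₁ (h00 hz₁)
  obtain ⟨j, G₁, hG₁a, hG₁0, hGev⟩ := (hGa z₀ hz₀).exists_eventuallyEq_pow_smul_nonzero_iff.2 hG_ne
  -- derivative forms near `z₀`
  have hdf_ev := deriv_of_eventuallyEq_pow_smul hf₁a hfev
  have hdF_ev := deriv_of_eventuallyEq_pow_smul hF₁a hFev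
  have hdG_ev := deriv_of_eventuallyEq_pow_smul hG₁a hGev
  have hf₁ne : ∀ᶠ z in 𝓝 z₀, f₁ z ≠ 0 := hf₁a.continuousAt.eventually_ne hf₁0
  -- the holomorphic part `v` of `u' = (f'/f)'` at `z₀`
  set v : ℂ → ℂ := fun z => deriv (fun w => deriv f₁ w / f₁ w) z with hv
  have hq_an : AnalyticAt ℂ (fun w => deriv f₁ w / f₁ w) z₀ := hf₁a.deriv.div hf₁a hf₁0
  have hv_cont : ContinuousAt v z₀ := hq_an.deriv.continuousAt
  -- Step 4: on a punctured neighbourhood, `(z - z₀) · A z = c · B z`.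
  set A : ℂ → ℂ := fun z => ((j : ℂ) - k) * G₁ z * F₁ z +
    (z - z₀) * (deriv G₁ z * F₁ z - G₁ z * deriv F₁ z) with hA
  set B : ℂ → ℂ := fun z => (-(m' + 1 : ℕ) + (z - z₀) ^ 2 * v z) * G₁ z * F₁ z with hB
  have hloc : ∀ᶠ z in 𝓝[≠] z₀, (z - z₀) * A z = c * B z := by
    -- gather everything valid near z₀, plus `z ≠ z₀`
    have hU_ev : ∀ᶠ z in 𝓝 z₀, z ∈ U := hUo.mem_nhds hz₀
    have hf₁an_ev := hf₁a.eventually_analyticAt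
    have hfev2 := hfev.eventually_nhds
    have hdfev2 := hdf_ev.eventually_nhds
    have hf₁ne2 := hf₁ne.eventually_nhds
    have hall : ∀ᶠ z in 𝓝 z₀, z ≠ z₀ → (z - z₀) * A z = c * B z := by
      filter_upwards [hU_ev, hfev, hdf_ev, hFev, hdF_ev, hGev, hdG_ev, hf₁ne, hf₁an_ev, hfev2, hdfev2,
        hf₁ne2] with z hzU hfz hdfz hFz hdFz hGz hdGz hf₁z hf₁an hfz2 hdfz2 hf₁ne2z hne
      have hw : z - z₀ ≠ 0 := sub_ne_zero.2 hne
      simp only [smul_eq_mul] at hfz hFz hGz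
      have hfz' : xiRot z ≠ 0 := by
        rw [hfz]; exact mul_ne_zero (pow_ne_zero _ hw) hf₁z
      -- (a) quotient rule for u at z
      have hf_an : AnalyticAt ℂ xiRot z := hfa z hzU
      have hdf : HasDerivAt xiRot (deriv xiRot z) z := hf_an.differentiableAt.hasDerivAt
      have hddf : HasDerivAt (deriv xiRot) (deriv (deriv xiRot) z) z :=
        hf_an.deriv.differentiableAt.hasDerivAt
      have hu1 : HasDerivAt u
          ((deriv (deriv xiRot) z * xiRot z - deriv xiRot z * deriv xiRot z) / xiRot z ^ 2) z :=
        hddf.div hdf hfz'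
      -- (b) local form of u near z and its derivative
      have hu_ev : u =ᶠ[𝓝 z] fun w => ((m' + 1 : ℕ) : ℂ) / (w - z₀) + deriv f₁ w / f₁ w := by
        have hne_ev : ∀ᶠ w in 𝓝 z, w ≠ z₀ := isOpen_ne.mem_nhds hne
        filter_upwards [hne_ev, hfz2, hdfz2, hf₁ne2z] with w hwne hfw hdfw hf₁w
        have hw' : w - z₀ ≠ 0 := sub_ne_zero.2 hwne
        simp only [smul_eq_mul] at hfw
        simp only [hu, hfw, hdfw, Nat.add_sub_cancel]
        field_simp
        ring
      have hq_z : AnalyticAt ℂ (fun w => deriv f₁ w / f₁ w) z := hf₁an.deriv.div hf₁an hf₁z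
      have hinv : HasDerivAt (fun w : ℂ => ((m' + 1 : ℕ) : ℂ) / (w - z₀))
          (-((m' + 1 : ℕ) : ℂ) / (z - z₀) ^ 2) z :=
        ((hasDerivAt_const z (((m' + 1 : ℕ) : ℂ))).div ((hasDerivAt_id' z).sub_const z₀) hw).congr_deriv
          (by ring)
      have hu2 : HasDerivAt u (-((m' + 1 : ℕ) : ℂ) / (z - z₀) ^ 2 + v z) z := by
        have h := hinv.add hq_z.differentiableAt.hasDerivAt
        exact (h.congr_of_eventuallyEq hu_ev)
      have hueq := hu1.unique hu2
      -- (c) the identity P z = Q z with f² cancelled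
      have hPQz := hPQ hzU
      simp only [hP, hQdef] at hPQz
      -- f'' f - f'² = (u') f²
      have hW : deriv (deriv xiRot) z * xiRot z - deriv xiRot z ^ 2 =
          (-((m' + 1 : ℕ) : ℂ) / (z - z₀) ^ 2 + v z) * xiRot z ^ 2 := by
        rw [← hueq]; field_simp
      rw [hW] at hPQz
      have hstar : deriv G z * F z - G z * deriv F z =
          c * (-((m' + 1 : ℕ) : ℂ) / (z - z₀) ^ 2 + v z) * G z * F z := by
        have h2 : xiRot z ^ 2 ≠ 0 := pow_ne_zero 2 hfz'
        apply mul_right_cancel₀ h2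
        rw [hPQz]; ring
      -- substitute the factorisations, multiply by (z - z₀)², cancel (z - z₀)^(j+k)
      rw [hdGz, hdFz, hGz, hFz] at hstar
      have hj2 := natCast_mul_pow_pred_mul_sq j (z - z₀)
      have hk2 := natCast_mul_pow_pred_mul_sq k (z - z₀)
      have hpow : (z - z₀) ^ (j + k) ≠ 0 := pow_ne_zero _ hw
      apply mul_left_cancel₀ hpow
      calc (z - z₀) ^ (j + k) * ((z - z₀) * A z)
          = ((↑j * (z - z₀) ^ (j - 1) * G₁ z + (z - z₀) ^ j * deriv G₁ z) * ((z - z₀) ^ k * F₁ z) -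
              (z - z₀) ^ j * G₁ z * (↑k * (z - z₀) ^ (k - 1) * F₁ z + (z - z₀) ^ k * deriv F₁ z)) *
              (z - z₀) ^ 2 := by
            simp only [hA]; rw [pow_add]
            linear_combination (-(z - z₀) ^ k * G₁ z * F₁ z) * hj2 + ((z - z₀) ^ j * G₁ z * F₁ z) * hk2
        _ = (c * (-((m' + 1 : ℕ) : ℂ) / (z - z₀) ^ 2 + v z) * ((z - z₀) ^ j * G₁ z) *
              ((z - z₀) ^ k * F₁ z)) * (z - z₀) ^ 2 := by rw [hstar]
        _ = (z - z₀) ^ (j + k) * (c * B z) := by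
            simp only [hB]; rw [pow_add]; field_simp
    refine eventually_nhdsWithin_iff.2 ?_
    filter_upwards [hall] with z hz hne
    exact hz hne
  -- Step 5: limits along `𝓝[≠] z₀`.
  have hA_cont : ContinuousAt A z₀ := by
    have h1 := hG₁a.continuousAt; have h2 := hF₁a.continuousAt
    have h3 := hG₁a.deriv.continuousAt; have h4 := hF₁a.deriv.continuousAt
    simp only [hA]
    fun_prop
  have hB_cont : ContinuousAt B z₀ := by
    have h1 := hG₁a.continuousAt; have h2 := hF₁a.continuousAt
    simp only [hB]
    fun_prop
  have hlim1 : Filter.Tendsto (fun z => (z - z₀) * A z) (𝓝[≠] z₀) (𝓝 0) := by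
    have h1 : Filter.Tendsto (fun z : ℂ => z - z₀) (𝓝 z₀) (𝓝 0) :=
      tendsto_sub_nhds_zero_iff.2 Filter.tendsto_id
    have h2 := (h1.mul hA_cont.tendsto)
    simp only [zero_mul] at h2
    exact h2.mono_left nhdsWithin_le_nhds
  have hlim2 : Filter.Tendsto (fun z => c * B z) (𝓝[≠] z₀) (𝓝 (c * B z₀)) :=
    (hB_cont.tendsto.const_mul c).mono_left nhdsWithin_le_nhds
  have hEq : (0 : ℂ) = c * B z₀ := tendsto_nhds_unique (hlim1.congr' hloc) hlim2
  have hB0 : B z₀ ≠ 0 := by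
    simp only [hB, sub_self, zero_pow two_ne_zero, zero_mul, add_zero]
    exact mul_ne_zero (mul_ne_zero (neg_ne_zero.2 (Nat.cast_ne_zero.2 (Nat.succ_ne_zero m'))) hG₁0) hF₁0
  exact mul_ne_zero hc0 hB0 hEq.symm

end Summit.RiemannHypothesis.RiemannHypothesis.Theorems.SuzukiDoor

end
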